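import Summits.Ventures.CertifiedManyBodySolver.Upper.IntervalReaderSchur

/-!
# Ventures/CertifiedManyBodySolver — Upper/IntervalReaderTransfer.lean: the Gram constant `κ` and the transfer bound (L1)
(Theorem H1′ of the interval reader, part 2 of 3)

HONEST FRAMING: first certified bounds; not a superconductivity verdict; every number certified or labelled
float.  This file bounds A READER'S OWN ROUNDING; it says nothing about the Hubbard model, a producer, a row,
or the thermodynamic limit.

Source (prose, read against the code): `HOME/sr-mbsolver-ird-2/pages/THEOREM-H1PRIME-PROOF-NOTE.md` (ird-2 g0,
sha16 954c3f3b30371ea8; E1-READER-PACKET §3 EDITION TODO 4; referee R2.63 (γ′)), describing `l3core/h1sweep.py`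
of the Theorem-H1′ INTERVAL reader (binary of record `l3core 0.6.8`).  One sweep step sends the
environment `Y` (a `χ_x × χ_x` block entering site `x`) through `T_O(Y) = Σ_{s,s′} O[s,s′] · (A^s)ᴴ · Y · A^{s′}`
(`transferOp`), where `A^s : χ_x × χ_{x+1}` are the (rescaled, dyadic) site slices and `O` is an integer `4 × 4` site
operator of E1's automaton MPO.  Proved here:

* `sum_norm_sq_mulVec_eq_re_inner_gram` / `sum_norm_sq_mulVec_le_of_gram` / `sum_norm_sq_mulVec_le_of_gram_row_sum` —
  the GRAM CONSTANT: `Σ_s ‖A^s z‖₂² = Re ⟪z, G z⟫ ≤ κ ‖z‖₂²` for `G = Σ_s (A^s)ᴴ A^s` and `κ = ‖G‖₂`, or `κ =` any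
  bound of the absolute ROW SUMS of `G` (what `gram_kappas` computes exactly in integers, `× 4^(−p)`);
* `norm_sum_conjTranspose_mulVec_le` — the ADJOINT STACK `‖Σ_s (A^s)ᴴ w_s‖₂ ≤ √κ · √(Σ_s ‖w_s‖₂²)` (i.e.
  `‖Vᴴ‖₂ ≤ √κ` for `V = (A^s)_s`, without forming `V`);
* `l2_opNorm_transferOp_le` — the note's (L1): `‖T_O(Y)‖₂ ≤ √(R·C) · κ · ‖Y‖₂` with `R, C` bounding the absolute
  row / column sums of `O` (the code uses `max (R, C) ≥ √(R·C)`);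
* `l2_opNorm_sum_smul_conjTranspose_mul_le` — the MID-ROUNDING term of H1′:
  `‖Σ_{s,s′} O[s,s′] · (A^s)ᴴ · W_{s′}‖₂ ≤ √κ · √(R·C) · √(Σ_{s′} ‖W_{s′}‖₂²)` for any blocks `W_{s′}` (the
  rounding defects of the intermediate products), `= √κ_x · ‖O‖ · ρ¹_x` with the part-1 defect bound.

Elementary (Cauchy–Schwarz, twice); no claim about the Hubbard model.
-/

noncomputable section

open Matrix Finset WithLp
open scoped BigOperators ComplexOrder

namespace Summit.Ventures.CertifiedManyBodySolver.Upper.IntervalReader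

section L2

open scoped Matrix.Norms.L2Operator InnerProductSpace

variable {𝕜 : Type*} [RCLike 𝕜]
variable {m n S : Type*} [Fintype m] [Fintype n] [Fintype S]

/-! ## §C  The Gram constant `κ`, the adjoint stack, and the transfer bound (L1) -/

/-- Adjointness on coordinate space: `⟪A x, y⟫ = ⟪x, Aᴴ y⟫`. -/
theorem inner_toLp_mulVec_left (A : Matrix m n 𝕜) (x : n → 𝕜) (y : m → 𝕜) :
    ⟪toLp 2 (A *ᵥ x), toLp 2 y⟫_𝕜 = ⟪toLp 2 x, toLp 2 (Aᴴ *ᵥ y)⟫_𝕜 := by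
  rw [EuclideanSpace.inner_toLp_toLp, EuclideanSpace.inner_toLp_toLp, Matrix.star_mulVec,
    dotProduct_comm, ← Matrix.dotProduct_mulVec, dotProduct_comm]

/-- Adjointness, the other way round: `⟪Aᴴ y, x⟫ = ⟪y, A x⟫`. -/
theorem inner_toLp_conjTranspose_mulVec_left (A : Matrix m n 𝕜) (y : m → 𝕜) (x : n → 𝕜) :
    ⟪toLp 2 (Aᴴ *ᵥ y), toLp 2 x⟫_𝕜 = ⟪toLp 2 y, toLp 2 (A *ᵥ x)⟫_𝕜 := by
  rw [inner_toLp_mulVec_left, Matrix.conjTranspose_conjTranspose]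

/-- **The Gram form.**  `Σ_s ‖A s z‖₂² = Re ⟪z, (Σ_s (A s)ᴴ A s) z⟫`. -/
theorem sum_norm_sq_mulVec_eq_re_inner_gram (A : S → Matrix m n 𝕜) (z : EuclideanSpace 𝕜 n) :
    ∑ s, ‖toLp 2 (A s *ᵥ ofLp z)‖ ^ 2
      = RCLike.re ⟪z, toLp 2 ((∑ s, (A s)ᴴ * A s) *ᵥ ofLp z)⟫_𝕜 := by
  rw [Matrix.sum_mulVec, toLp_sum, inner_sum, map_sum]
  refine Finset.sum_congr rfl fun s _ => ?_
  rw [← inner_self_eq_norm_sq (𝕜 := 𝕜), ← Matrix.mulVec_mulVec, ← inner_toLp_mulVec_left]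

/-- **κ from the operator norm of the Gram matrix.**  `Σ_s ‖A s z‖₂² ≤ ‖Σ_s (A s)ᴴ A s‖₂ · ‖z‖₂²`. -/
theorem sum_norm_sq_mulVec_le_of_gram [DecidableEq n] (A : S → Matrix m n 𝕜) (z : EuclideanSpace 𝕜 n) :
    ∑ s, ‖toLp 2 (A s *ᵥ ofLp z)‖ ^ 2 ≤ ‖∑ s, (A s)ᴴ * A s‖ * ‖z‖ ^ 2 := by
  rw [sum_norm_sq_mulVec_eq_re_inner_gram]
  set G : Matrix n n 𝕜 := ∑ s, (A s)ᴴ * A s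
  calc RCLike.re ⟪z, toLp 2 (G *ᵥ ofLp z)⟫_𝕜
      ≤ ‖z‖ * ‖toLp 2 (G *ᵥ ofLp z)‖ := re_inner_le_norm _ _
    _ ≤ ‖z‖ * (‖G‖ * ‖z‖) :=
        mul_le_mul_of_nonneg_left (Matrix.l2_opNorm_mulVec G z) (norm_nonneg _)
    _ = ‖G‖ * ‖z‖ ^ 2 := by ring

/-- **κ as the code computes it** (`gram_kappas`: the maximum absolute ROW SUM of the exact integer Gram matrix,
times `4^(−p)`): if every absolute row sum of `G = Σ_s (A s)ᴴ A s` is `≤ κ`, then `Σ_s ‖A s z‖₂² ≤ κ · ‖z‖₂²`.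
(`G` is Hermitian, so its column sums are its row sums and the Schur test gives `‖G‖₂ ≤ κ`.) -/
theorem sum_norm_sq_mulVec_le_of_gram_row_sum [DecidableEq n] (A : S → Matrix m n 𝕜) {κ : ℝ}
    (hrow : ∀ i, ∑ j, ‖(∑ s, (A s)ᴴ * A s) i j‖ ≤ κ) (z : EuclideanSpace 𝕜 n) :
    ∑ s, ‖toLp 2 (A s *ᵥ ofLp z)‖ ^ 2 ≤ κ * ‖z‖ ^ 2 := by
  set G : Matrix n n 𝕜 := ∑ s, (A s)ᴴ * A s with hG
  have hGh : Gᴴ = G := by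
    simp only [hG, Matrix.conjTranspose_sum, Matrix.conjTranspose_mul, Matrix.conjTranspose_conjTranspose]
  have hcol : ∀ j, ∑ i, ‖G i j‖ ≤ κ := by
    intro j
    have : ∀ i, ‖G i j‖ = ‖G j i‖ := fun i => by
      rw [← hGh, Matrix.conjTranspose_apply, norm_star, hGh]
    simp only [this]
    exact hrow j
  rcases isEmpty_or_nonempty n with hn | ⟨⟨i₀⟩⟩
  · -- degenerate case, no columns: both sides vanish
    have hl : ∀ s, ‖toLp 2 (A s *ᵥ ofLp z)‖ = 0 := fun s => by
      simp [EuclideanSpace.norm_eq, Matrix.mulVec, dotProduct]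
    have hz : ‖z‖ = 0 := by simp [EuclideanSpace.norm_eq]
    simp [hl, hz]
  have hκ0 : 0 ≤ κ := (Finset.sum_nonneg fun j _ => norm_nonneg (G i₀ j)).trans (hrow i₀)
  have hGn : ‖G‖ ≤ κ := by
    have := l2_opNorm_le_sqrt_row_mul_col G hκ0 hκ0 hrow hcol
    rwa [Real.sqrt_mul_self hκ0] at this
  exact (sum_norm_sq_mulVec_le_of_gram A z).trans
    (mul_le_mul_of_nonneg_right hGn (sq_nonneg _))

/-- **The adjoint stack.**  If `Σ_s ‖A s z‖₂² ≤ κ‖z‖₂²` for all `z`, then for every family of vectors `w s`,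
`‖Σ_s (A s)ᴴ w s‖₂ ≤ √κ · √(Σ_s ‖w s‖₂²)` — the bound `‖Vᴴ‖₂ = ‖V‖₂ ≤ √κ` for the stacked matrix `V = (A s)_s`
without forming `V`. -/
theorem norm_sum_conjTranspose_mulVec_le (A : S → Matrix m n 𝕜) {κ : ℝ} (hκ0 : 0 ≤ κ)
    (hκ : ∀ z : EuclideanSpace 𝕜 n, ∑ s, ‖toLp 2 (A s *ᵥ ofLp z)‖ ^ 2 ≤ κ * ‖z‖ ^ 2)
    (w : S → EuclideanSpace 𝕜 m) :
    ‖∑ s, toLp 2 ((A s)ᴴ *ᵥ ofLp (w s))‖ ≤ Real.sqrt κ * Real.sqrt (∑ s, ‖w s‖ ^ 2) := by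
  set z : EuclideanSpace 𝕜 n := ∑ s, toLp 2 ((A s)ᴴ *ᵥ ofLp (w s)) with hz
  -- ‖z‖² = Re ⟪z, z⟫ = Σ_s Re ⟪w s, A s z⟫ ≤ Σ_s ‖w s‖ ‖A s z‖ ≤ √(Σ‖w‖²) √(Σ‖A z‖²) ≤ √(Σ‖w‖²) √κ ‖z‖.
  have hzz : ‖z‖ ^ 2 = ∑ s, RCLike.re ⟪w s, toLp 2 (A s *ᵥ ofLp z)⟫_𝕜 := by
    rw [← inner_self_eq_norm_sq (𝕜 := 𝕜)]
    conv_lhs => rw [hz]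
    rw [sum_inner, map_sum]
    refine Finset.sum_congr rfl fun s _ => ?_
    rw [show z = toLp 2 (ofLp z) from rfl, inner_toLp_conjTranspose_mulVec_left]
  have hbound : ‖z‖ ^ 2 ≤ (Real.sqrt κ * Real.sqrt (∑ s, ‖w s‖ ^ 2)) * ‖z‖ := by
    rw [hzz]
    calc ∑ s, RCLike.re ⟪w s, toLp 2 (A s *ᵥ ofLp z)⟫_𝕜
        ≤ ∑ s, ‖w s‖ * ‖toLp 2 (A s *ᵥ ofLp z)‖ := Finset.sum_le_sum fun s _ => re_inner_le_norm _ _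
      _ ≤ Real.sqrt (∑ s, ‖w s‖ ^ 2) * Real.sqrt (∑ s, ‖toLp 2 (A s *ᵥ ofLp z)‖ ^ 2) := by
          have hcs := Finset.sum_mul_sq_le_sq_mul_sq (s := Finset.univ) (f := fun s => ‖w s‖)
            (g := fun s => ‖toLp 2 (A s *ᵥ ofLp z)‖)
          rw [← Real.sqrt_mul (Finset.sum_nonneg fun s _ => sq_nonneg _)]
          exact Real.le_sqrt_of_sq_le hcs
      _ ≤ Real.sqrt (∑ s, ‖w s‖ ^ 2) * (Real.sqrt κ * ‖z‖) := by
          refine mul_le_mul_of_nonneg_left ?_ (Real.sqrt_nonneg _)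
          have := Real.sqrt_le_sqrt (hκ z)
          rwa [Real.sqrt_mul hκ0, Real.sqrt_sq (norm_nonneg _)] at this
      _ = (Real.sqrt κ * Real.sqrt (∑ s, ‖w s‖ ^ 2)) * ‖z‖ := by ring
  have hc0 : 0 ≤ Real.sqrt κ * Real.sqrt (∑ s, ‖w s‖ ^ 2) :=
    mul_nonneg (Real.sqrt_nonneg _) (Real.sqrt_nonneg _)
  -- from ‖z‖² ≤ c‖z‖ and c ≥ 0 conclude ‖z‖ ≤ c
  rcases (norm_nonneg z).eq_or_lt with h0 | hpos
  · rw [← h0]; exact hc0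
  · exact le_of_mul_le_mul_right (by rw [← sq]; exact hbound) hpos

/-- **Vector form of (L1) with the automaton operator.**  With `κ` as above and an operator `O : S × S → 𝕜`
whose absolute row sums are `≤ R` and column sums `≤ C`, every family of vectors `w s′` satisfies
`‖Σ_{s,s′} O s s′ • (A s)ᴴ w s′‖₂ ≤ √κ · √(R·C) · √(Σ_{s′} ‖w s′‖₂²)`. -/
theorem norm_sum_sum_smul_conjTranspose_mulVec_le (A : S → Matrix m n 𝕜) {κ : ℝ} (hκ0 : 0 ≤ κ)
    (hκ : ∀ z : EuclideanSpace 𝕜 n, ∑ s, ‖toLp 2 (A s *ᵥ ofLp z)‖ ^ 2 ≤ κ * ‖z‖ ^ 2)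
    (O : Matrix S S 𝕜) {R C : ℝ} (hR0 : 0 ≤ R) (hC0 : 0 ≤ C)
    (hrow : ∀ s, ∑ s', ‖O s s'‖ ≤ R) (hcol : ∀ s', ∑ s, ‖O s s'‖ ≤ C)
    (w : S → EuclideanSpace 𝕜 m) :
    ‖∑ s, ∑ s', O s s' • toLp 2 ((A s)ᴴ *ᵥ ofLp (w s'))‖
      ≤ Real.sqrt κ * Real.sqrt (R * C) * Real.sqrt (∑ s', ‖w s'‖ ^ 2) := by
  -- regroup: Σ_s (A s)ᴴ (u s) with u s = Σ_{s'} O s s' • w s'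
  set u : S → EuclideanSpace 𝕜 m := fun s => ∑ s', O s s' • w s' with hu
  have hregroup : ∑ s, ∑ s', O s s' • toLp 2 ((A s)ᴴ *ᵥ ofLp (w s'))
      = ∑ s, toLp 2 ((A s)ᴴ *ᵥ ofLp (u s)) := by
    refine Finset.sum_congr rfl fun s _ => ?_
    simp only [hu, ofLp_sum, ofLp_smul, Matrix.mulVec_sum, Matrix.mulVec_smul, toLp_sum, toLp_smul]
  rw [hregroup]
  refine (norm_sum_conjTranspose_mulVec_le A hκ0 hκ u).trans ?_
  rw [mul_assoc]
  refine mul_le_mul_of_nonneg_left ?_ (Real.sqrt_nonneg _)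
  -- √(Σ_s ‖u s‖²) ≤ √(RC) √(Σ ‖w‖²)
  rw [← Real.sqrt_mul (mul_nonneg hR0 hC0)]
  refine Real.sqrt_le_sqrt ?_
  calc ∑ s, ‖u s‖ ^ 2
      ≤ ∑ s, (∑ s', ‖O s s'‖ * ‖w s'‖) ^ 2 := by
        refine Finset.sum_le_sum fun s _ => pow_le_pow_left₀ (norm_nonneg _) ?_ 2
        exact (norm_sum_le _ _).trans (Finset.sum_le_sum fun s' _ => (norm_smul _ _).le)
    _ ≤ R * C * ∑ s', ‖w s'‖ ^ 2 :=
        sum_sq_sum_mul_le (fun s s' => ‖O s s'‖) (fun _ _ => norm_nonneg _) hR0 hrow hcol _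

omit [Fintype n] in
/-- The transfer operator of one sweep step through one automaton entry: `Y ↦ Σ_{s,s′} O s s′ • (A s)ᴴ · Y · A s′`
(`T_O` of the note; `O` = the integer `4 × 4` site operator `I4 / P / NN / HL↑ / …` of E1's automaton MPO,
`A s` the site slice, `Y` the environment entering the site). -/
def transferOp (A : S → Matrix m n 𝕜) (O : Matrix S S 𝕜) (Y : Matrix m m 𝕜) : Matrix n n 𝕜 :=
  ∑ s, ∑ s', O s s' • ((A s)ᴴ * Y * A s')

omit [Fintype n] in
/-- `transferOp` is additive in the environment (it is linear; additivity is what the skeleton needs). -/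
theorem transferOp_sub (A : S → Matrix m n 𝕜) (O : Matrix S S 𝕜) (Y Y' : Matrix m m 𝕜) :
    transferOp A O (Y - Y') = transferOp A O Y - transferOp A O Y' := by
  simp only [transferOp, Matrix.mul_sub, Matrix.sub_mul, smul_sub, Finset.sum_sub_distrib]

omit [Fintype n] in
/-- `transferOp` as an additive monoid homomorphism of the environment. -/
def transferOpHom (A : S → Matrix m n 𝕜) (O : Matrix S S 𝕜) : Matrix m m 𝕜 →+ Matrix n n 𝕜 where
  toFun := transferOp A O
  map_zero' := by simp [transferOp]
  map_add' Y Y' := by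
    simp only [transferOp, Matrix.mul_add, Matrix.add_mul, smul_add, Finset.sum_add_distrib]

omit [Fintype n] in
/-- `transferOpHom` is `transferOp`. -/
@[simp] theorem transferOpHom_apply (A : S → Matrix m n 𝕜) (O : Matrix S S 𝕜) (Y : Matrix m m 𝕜) :
    transferOpHom A O Y = transferOp A O Y := rfl

/-- **(L1) — the transfer bound.**  `‖Σ_{s,s′} O s s′ • (A s)ᴴ Y (A s′)‖₂ ≤ √(R·C) · κ · ‖Y‖₂`, with `R, C` bounding
the absolute row / column sums of `O` and `κ` any Gram constant of the slices (`sum_norm_sq_mulVec_le_of_gram`,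
`sum_norm_sq_mulVec_le_of_gram_row_sum`).  The code uses `max (R, C) ≥ √(R·C)` (`sqrt_mul_le_max`). -/
theorem l2_opNorm_transferOp_le [DecidableEq m] [DecidableEq n] (A : S → Matrix m n 𝕜) {κ : ℝ} (hκ0 : 0 ≤ κ)
    (hκ : ∀ z : EuclideanSpace 𝕜 n, ∑ s, ‖toLp 2 (A s *ᵥ ofLp z)‖ ^ 2 ≤ κ * ‖z‖ ^ 2)
    (O : Matrix S S 𝕜) {R C : ℝ} (hR0 : 0 ≤ R) (hC0 : 0 ≤ C)
    (hrow : ∀ s, ∑ s', ‖O s s'‖ ≤ R) (hcol : ∀ s', ∑ s, ‖O s s'‖ ≤ C) (Y : Matrix m m 𝕜) :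
    ‖transferOp A O Y‖ ≤ Real.sqrt (R * C) * κ * ‖Y‖ := by
  rw [Matrix.l2_opNorm_def (transferOp A O Y)]
  refine ContinuousLinearMap.opNorm_le_bound _ (by positivity) fun v => ?_
  change ‖toLp 2 (transferOp A O Y *ᵥ ofLp v)‖ ≤ _
  -- (T Y) v = Σ_{s,s'} O s s' • (A s)ᴴ (Y (A s' v))
  set w : S → EuclideanSpace 𝕜 m := fun s' => toLp 2 (Y *ᵥ (A s' *ᵥ ofLp v)) with hw
  have hexp : toLp 2 (transferOp A O Y *ᵥ ofLp v)
      = ∑ s, ∑ s', O s s' • toLp 2 ((A s)ᴴ *ᵥ ofLp (w s')) := by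
    simp only [transferOp, Matrix.sum_mulVec, Matrix.smul_mulVec, ← Matrix.mulVec_mulVec, toLp_sum,
      toLp_smul, hw, ofLp_toLp]
  rw [hexp]
  refine (norm_sum_sum_smul_conjTranspose_mulVec_le A hκ0 hκ O hR0 hC0 hrow hcol w).trans ?_
  -- √(Σ ‖w s'‖²) ≤ ‖Y‖ √κ ‖v‖
  have hws : ∑ s', ‖w s'‖ ^ 2 ≤ (‖Y‖ * (Real.sqrt κ * ‖v‖)) ^ 2 := by
    calc ∑ s', ‖w s'‖ ^ 2
        ≤ ∑ s', (‖Y‖ * ‖toLp 2 (A s' *ᵥ ofLp v)‖) ^ 2 := by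
          refine Finset.sum_le_sum fun s' _ => pow_le_pow_left₀ (norm_nonneg _) ?_ 2
          exact Matrix.l2_opNorm_mulVec Y (toLp 2 (A s' *ᵥ ofLp v))
      _ = ‖Y‖ ^ 2 * ∑ s', ‖toLp 2 (A s' *ᵥ ofLp v)‖ ^ 2 := by
          rw [Finset.mul_sum]; refine Finset.sum_congr rfl fun s' _ => by ring
      _ ≤ ‖Y‖ ^ 2 * (κ * ‖v‖ ^ 2) := mul_le_mul_of_nonneg_left (hκ v) (sq_nonneg _)
      _ = (‖Y‖ * (Real.sqrt κ * ‖v‖)) ^ 2 := by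
          rw [mul_pow, mul_pow, Real.sq_sqrt hκ0]
  have hsq : Real.sqrt (∑ s', ‖w s'‖ ^ 2) ≤ ‖Y‖ * (Real.sqrt κ * ‖v‖) := by
    rw [← Real.sqrt_sq (show 0 ≤ ‖Y‖ * (Real.sqrt κ * ‖v‖) by positivity)]
    exact Real.sqrt_le_sqrt hws
  calc Real.sqrt κ * Real.sqrt (R * C) * Real.sqrt (∑ s', ‖w s'‖ ^ 2)
      ≤ Real.sqrt κ * Real.sqrt (R * C) * (‖Y‖ * (Real.sqrt κ * ‖v‖)) :=
        mul_le_mul_of_nonneg_left hsq (by positivity)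
    _ = Real.sqrt (R * C) * (Real.sqrt κ * Real.sqrt κ) * ‖Y‖ * ‖v‖ := by ring
    _ = Real.sqrt (R * C) * κ * ‖Y‖ * ‖v‖ := by rw [Real.mul_self_sqrt hκ0]

/-- **The mid-rounding term of H1′.**  For ANY family of blocks `W s′ : m × n` (in the reader: the rounding defects
of the intermediate products `X̂[b] · A s′`), `‖Σ_{s,s′} O s s′ • (A s)ᴴ · W s′‖₂ ≤ √κ · √(R·C) · √(Σ_{s′} ‖W s′‖₂²)`;
with `‖W s′‖₂ ≤ √(χ_x χ_{x+1}) · 2^(−P−1)` on `#s′` values and `0` elsewhere this is `√κ_x · ‖O‖ · ρ¹_x`. -/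
theorem l2_opNorm_sum_smul_conjTranspose_mul_le [DecidableEq n] (A : S → Matrix m n 𝕜) {κ : ℝ} (hκ0 : 0 ≤ κ)
    (hκ : ∀ z : EuclideanSpace 𝕜 n, ∑ s, ‖toLp 2 (A s *ᵥ ofLp z)‖ ^ 2 ≤ κ * ‖z‖ ^ 2)
    (O : Matrix S S 𝕜) {R C : ℝ} (hR0 : 0 ≤ R) (hC0 : 0 ≤ C)
    (hrow : ∀ s, ∑ s', ‖O s s'‖ ≤ R) (hcol : ∀ s', ∑ s, ‖O s s'‖ ≤ C) (W : S → Matrix m n 𝕜) :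
    ‖∑ s, ∑ s', O s s' • ((A s)ᴴ * W s')‖
      ≤ Real.sqrt κ * Real.sqrt (R * C) * Real.sqrt (∑ s', ‖W s'‖ ^ 2) := by
  rw [Matrix.l2_opNorm_def (∑ s, ∑ s', O s s' • ((A s)ᴴ * W s'))]
  refine ContinuousLinearMap.opNorm_le_bound _ (by positivity) fun v => ?_
  change ‖toLp 2 ((∑ s, ∑ s', O s s' • ((A s)ᴴ * W s')) *ᵥ ofLp v)‖ ≤ _
  set w : S → EuclideanSpace 𝕜 m := fun s' => toLp 2 (W s' *ᵥ ofLp v) with hw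
  have hexp : toLp 2 ((∑ s, ∑ s', O s s' • ((A s)ᴴ * W s')) *ᵥ ofLp v)
      = ∑ s, ∑ s', O s s' • toLp 2 ((A s)ᴴ *ᵥ ofLp (w s')) := by
    simp only [Matrix.sum_mulVec, Matrix.smul_mulVec, ← Matrix.mulVec_mulVec, toLp_sum, toLp_smul, hw,
      ofLp_toLp]
  rw [hexp]
  refine (norm_sum_sum_smul_conjTranspose_mulVec_le A hκ0 hκ O hR0 hC0 hrow hcol w).trans ?_
  have hws : ∑ s', ‖w s'‖ ^ 2 ≤ (Real.sqrt (∑ s', ‖W s'‖ ^ 2) * ‖v‖) ^ 2 := by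
    rw [mul_pow, Real.sq_sqrt (Finset.sum_nonneg fun _ _ => sq_nonneg _), Finset.sum_mul]
    refine Finset.sum_le_sum fun s' _ => ?_
    rw [← mul_pow]
    exact pow_le_pow_left₀ (norm_nonneg _) (Matrix.l2_opNorm_mulVec (W s') v) 2
  have hsq : Real.sqrt (∑ s', ‖w s'‖ ^ 2) ≤ Real.sqrt (∑ s', ‖W s'‖ ^ 2) * ‖v‖ := by
    rw [← Real.sqrt_sq (show 0 ≤ Real.sqrt (∑ s', ‖W s'‖ ^ 2) * ‖v‖ by positivity)]
    exact Real.sqrt_le_sqrt hws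
  calc Real.sqrt κ * Real.sqrt (R * C) * Real.sqrt (∑ s', ‖w s'‖ ^ 2)
      ≤ Real.sqrt κ * Real.sqrt (R * C) * (Real.sqrt (∑ s', ‖W s'‖ ^ 2) * ‖v‖) :=
        mul_le_mul_of_nonneg_left hsq (by positivity)
    _ = Real.sqrt κ * Real.sqrt (R * C) * Real.sqrt (∑ s', ‖W s'‖ ^ 2) * ‖v‖ := by ring

/-! ## §C″  The norm layer (`O = 1`): the identity automaton and the Heisenberg map -/

omit [Fintype n] in
/-- With the IDENTITY site operator the transfer operator is the Heisenberg (completely positive) map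
`Y ↦ Σ_s (A s)ᴴ · Y · A s` — the NORM layer of the reader (`B = ⟨ψ|ψ⟩`; in `h1sweep.py` the `En` update with
coefficient 1 for every `s`), and the tree's `heisenberg` of `Upper/UMPSPolarTensor.lean` up to the index types. -/
theorem transferOp_one [DecidableEq S] (A : S → Matrix m n 𝕜) (Y : Matrix m m 𝕜) :
    transferOp A (1 : Matrix S S 𝕜) Y = ∑ s, (A s)ᴴ * Y * A s := by
  unfold transferOp
  refine Finset.sum_congr rfl fun s _ => ?_
  rw [Finset.sum_eq_single s]
  · simp
  · intro s' _ hs'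
    simp [Matrix.one_apply_ne (Ne.symm hs')]
  · intro h; exact absurd (Finset.mem_univ s) h

/-- The absolute row and column sums of the identity operator are `1`. -/
theorem sum_norm_one_apply_row [DecidableEq S] (s : S) : ∑ s', ‖(1 : Matrix S S 𝕜) s s'‖ = 1 := by
  rw [Finset.sum_eq_single s]
  · simp
  · intro s' _ hs'; simp [Matrix.one_apply_ne (Ne.symm hs')]
  · intro h; exact absurd (Finset.mem_univ s) h

/-- Column version of `sum_norm_one_apply_row`. -/
theorem sum_norm_one_apply_col [DecidableEq S] (s' : S) : ∑ s, ‖(1 : Matrix S S 𝕜) s s'‖ = 1 := by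
  rw [Finset.sum_eq_single s']
  · simp
  · intro s _ hs; simp [Matrix.one_apply_ne hs]
  · intro h; exact absurd (Finset.mem_univ s') h

/-- **The norm-layer constant.**  `‖Σ_s (A s)ᴴ · Y · A s‖₂ ≤ κ · ‖Y‖₂`: the transfer bound (L1) with `O = 1`
(`R = C = 1`) — the recursion `rn = κ·rn + … + ρ` of `h1sweep.py` for `B = ⟨ψ|ψ⟩` carries operator constant `1`. -/
theorem l2_opNorm_heisenbergSum_le [DecidableEq m] [DecidableEq n] [DecidableEq S] (A : S → Matrix m n 𝕜)
    {κ : ℝ} (hκ0 : 0 ≤ κ)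
    (hκ : ∀ z : EuclideanSpace 𝕜 n, ∑ s, ‖toLp 2 (A s *ᵥ ofLp z)‖ ^ 2 ≤ κ * ‖z‖ ^ 2) (Y : Matrix m m 𝕜) :
    ‖∑ s, (A s)ᴴ * Y * A s‖ ≤ κ * ‖Y‖ := by
  have h := l2_opNorm_transferOp_le A hκ0 hκ (1 : Matrix S S 𝕜) zero_le_one zero_le_one
    (fun s => (sum_norm_one_apply_row (𝕜 := 𝕜) s).le) (fun s' => (sum_norm_one_apply_col (𝕜 := 𝕜) s').le) Y
  rwa [transferOp_one, mul_one, Real.sqrt_one, one_mul] at h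

end L2


end Summit.Ventures.CertifiedManyBodySolver.Upper.IntervalReader

end
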